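import Literature.MathematicalPhysics.QuantumFieldTheory.Balaban1983to89.B13InverseDecayWeightedPairing
import Literature.MathematicalPhysics.QuantumFieldTheory.Balaban1983to89.B13OpsYPencilGreen
import Literature.MathematicalPhysics.QuantumFieldTheory.Balaban1983to89.B13MatrixUnitBasisNumerals
import Literature.MathematicalPhysics.QuantumFieldTheory.Balaban1983to89.B9Thm31SiteGpBoundsReg335Y
import Literature.MathematicalPhysics.QuantumFieldTheory.Balaban1983to89.B13OpsYPencilDeltaALetters
import Literature.MathematicalPhysics.QuantumFieldTheory.Balaban1983to89.B9Thm311PosAtRecordV4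
import Literature.MathematicalPhysics.QuantumFieldTheory.Balaban1983to89.B9Thm311CoercivePureGaugeAtLettersY

/-!
# `Balaban1983to89.B13GreenCentreDecayOfCoercive` — T. Bałaban, *Propagators for lattice gauge theories in a background field*, Commun. Math. Phys. **99** (1985)
# 389–434 [Balaban1985BackgroundPropagators], (3.26)–(3.27) p. 395 («Δ_a = Δ + DRD* + Q*aQ», «G(U) = Δ_a(U)⁻¹»), Thm 3.3 p. 399 (G satisfies (3.42)–(3.47)), Thm 3.4 p. 400 and
# Sect. B (3.84)–(3.86) p. 407, Thm 3.10 (3.107)–(3.108) pp. 415–416, Thm 3.11 p. 416 («the operators Δ′_a, G′, (Q′G′²Q′*)⁻¹, Δ_a, G are positive definite»), with [4] =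
# *Propagators … II*, Commun. Math. Phys. **96** (1984) 223–250 [Balaban1984PropagatorsII] (2.19) and p. 226 («the operator Δ_a is bounded from below by a positive constant,
# hence … G = Δ_a⁻¹», (2.22)), Lemma 2.1 (2.61) p. 234; [Balaban1988RG2Cluster] (2.5)–(2.7) pp. 12–13:
# ★★★ THE CENTRE OF PRINT's LAST INVERSE `G(U₀) = Δ_a(U₀)⁻¹` FROM ONE DISPLAYED FORM BOUND — invertibility of `Δ_a(U₀)` AND the exponential decay of the matrix
# of `G(U₀)` from the COERCIVITY of `Δ_a(U₀)` in print's weighted trace pairing (Theorem 3.11 ∕ [4] p. 226 in quantitative currency, DISPLAYED) and the entry decay of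
# the matrix of `Δ_a(U₀)` (the N10 junction's own pencil letters read at the centre), by module 80's Combes–Thomas theorem; hence THE G-JUNCTION WITH ITS N06 CONTENT
# REDUCED TO THAT ONE FORM BOUND.

statement-level bookkeeping (a dictionary between the weighted trace pairing `trIP w` of `B9Thm311ReadingCoords` and the weighted accretivity hypothesis of module 80,
for operators on `S → M_N(ℂ)` over ANY finite index type `S`) + calls of cited tree theorems; kernel-checked; THEOREMS ONLY (no `def`, no `structure`, no instance,
no notation); NOTHING of NODE 00's ∕ N06's is modified; nothing here is a claim about the Yang–Mills mass gap; no node is discharged; count-neutral.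

WHY THIS FILE (cell `pub-ymgap`, HUMAN RULING D-0062 ∕ D-0149, Track A node N10 = [B13]; width seat `pub-ymgap-dag-n10-w2` g3, CLAIM-1 ∕ INTENT-1; self-located
from the lane's census `N10-RESIDUAL-CENSUS-v17.md` «What would move N10 next» item 1 — ITS N10 HALF — and the lane's located X⁻¹ recipe (INBOX l.29493)
transposed to `G`).  The N10 junction's readers for print's last inverse — `B13InverseOperatorCoordinates.rawEntryLetters_toMatrix_GAY_prodCfg_located` (p599011) and
the G-station `B13OpsYPencilGreen.rawEntryLetters_toMatrix_GAY_prodCfg_of_pencil` (p607869) — display TWO facts of N06's at the one real background `U₀`: `IsUnit (Δ_a(U₀))`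
(Thm 3.3: `G(U₀)` exists) and a (3.108)-type exponential decay of the matrix ∕ kernel of `G(U₀)` (Thms 3.3 ∕ 3.10).  For the block-sector inverse `(Q′G′²Q′*)⁻¹` the
lane showed (modules 80 ∕ 81) that BOTH follow from a LOWER FORM BOUND of the un-inverted operator plus the entry decay of its matrix, by a Combes–Thomas argument that
is generic.  THIS FILE runs the same road for `G = Δ_a⁻¹` on the bond sector, where the lower form bound is NOT a theorem of the tree (it is the bond-sector twin of
n06-w1's `B9Thm31SiteCoerciveReg335Y.trIP_deltaPrimeAY_parSymY_ge`, i.e. the content of Theorems 3.3 ∕ 3.11 for `Δ_a` on the (3.35) class — N06's) and is therefore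
DISPLAYED, in the quantitative shape of row 17's one clause (`B9Thm311PosAtRecordV4` §5: `PosDefTr 1 (Δ_a(U))`):
  `hco : ∀ Ψ, m·trIP w Ψ Ψ ≤ trIP w Ψ (Δ_a(U₀) Ψ)`, `m > 0`, `w > 0`.
With it the two displayed N06 inputs of the G-junction collapse to this ONE form bound: the entry decay of `toMatrix (Δ_a(U₀))` is the junction's OWN datum `hA`
(Δ_a's pencil letters — the lane's local part + n10-w2 g2's `D R D*` station) read at the centre `A′ = 0`.

WHAT THIS FILE PROVES (all `theorem`s; `𝔸 = M_N(ℂ)` with the L²-operator norm of record where a norm on `𝔸` is needed; product basis `B′ = (δ_s ⊗ E_{ab})` =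
`(Pi.basis fun _ => Matrix.stdBasis ℂ (Fin N) (Fin N)).reindex (Equiv.sigmaEquivProd S (Fin N × Fin N))`).
* §1 (ANY finite index type `S`, any weight `w : S → ℝ`) `piStd_repr_apply` (`B′`-coordinates are entries), `coe_piStd_repr_of`, ★ `weightedForm_toMatrix_eq_trIP`
  (`Re Σ_p w(p.1)·v̄_p·(toMatrix B′ B′ Φ · v)_p = trIP w g (Φ g)`), `weightedNormSq_eq_trIP`, ★ `weightedAccretive_toMatrix_of_trIP_coercive` (`hco` ⟹ module 80's
  weighted accretivity of `toMatrix B′ B′ Φ`).  (Module 81's §2 is the instance `S = BlkY i`, `w = wB i` of this dictionary, typed there first for `X`; not restated here.)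
* §2 (ANY `S`, any `Φ : Module.End ℂ (S → M_N(ℂ))`) ★★ `isUnit_and_norm_toMatrix_ringInverse_le_of_trIP_coercive`: `hco` (+ the weight-ratio numeral `Θ`:
  `√w s ≤ Θ·√w t`) + the entry decay `‖toMatrix B′ B′ Φ p q‖ ≤ a·e^{−κ₀ d₁(loc p, loc q)}` through a location map `loc : S × (N×N) → UT Nf` + half-rate volume sums `≤ c_V`
  ⟹ `IsUnit Φ` (n06-w1's `isUnit_of_coercive`, BY NAME) `∧ ‖toMatrix B′ B′ (Ring.inverse Φ) p q‖ ≤ Θ·(4∕m)·e^{−κ d₁(loc p, loc q)}` for `0 ≤ κ ≤ κ₀∕4`, `8(Θa)κc_V ≤ mκ₀`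
  (module 80 `inverse_decay_of_expDecay_weighted` + `toMatrix_ringInverse`); `…_flat` (`w = 1`, `Θ = 1`); `…_of_trIP_coercive_fibre` (the volume numeral from a
  fibre bound `m_F` of `loc`, `c_V = m_F·c₀(1,κ₀∕2)^ν` — `sum_fiber_le` + `rowSum_torus`, as in module 81 §4).
* §3 (NODE 00's `Δ_a ∕ G` on the bond sector `S = FBondY i`, ANY letters `parS parB Gp`, EVERY background `U₀` — no unitarity, no (3.35) used here)
  ★★ `isUnit_deltaAY_and_norm_toMatrix_GAY_le_of_coercive` (EXACTLY the pair `(hU, hG)` of `…GAY_prodCfg_located`, from `hco` + the entry decay of `toMatrix (Δ_a(U₀))`),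
  `entryDecay_centre_of_rawEntryLetters` (a `RawEntryLetters` datum read at the centre of its ball), ★★★ `rawEntryLetters_toMatrix_GAY_prodCfg_located_of_coercive`
  (Δ_a's pencil letters `hA : RawEntryLetters (A′ ↦ toMatrix (Δ_a(e^{iηA′}U₀))) loc R ρ B` + `hco` + `Θ` + a fibre bound `m_F` + `0 < R`, `0 < ρ` + a rate `κ ≤ ρ∕4` with
  `8(ΘB)κ(m_F c₀(1,ρ∕2)^ν) ≤ mρ` ⟹ `RawEntryLetters (A′ ↦ toMatrix (G(e^{iηA′}U₀))) loc R₁⋆ ρ′ (2Θ(4∕m))` for every `0 ≤ ρ′ < κ` — N06's content = `hco` ALONE),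
  `…_flat`.
* §4 ★★★ `rawEntryLetters_toMatrix_GAY_prodCfg_of_pencil_of_coercive` — n10-w2 g2's G-STATION (`B13OpsYPencilGreen` §3: `hA` assembled from the R-station's output `hR`
  and the local part's letters `hLoc` with NODE 00's `D ∕ D*` numerals) AT THE RECORD's ALGEBRA (`M_N(ℂ)`, `N ≥ 1`, matrix units, `cb = cl = 1`) with the G-step's two
  N06 inputs `hunit + hO` REPLACED BY `hco`: the END OF PRINT's CHAIN `G′ → (Q′G′²Q′*)⁻¹ → R → Δ_a → G` at NODE 00's operators along pv27's pencil displays, for the last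
  inverse, Theorem 3.11's printed conclusion for `Δ_a(U₀)` in quantitative form and nothing else of N06's (the G′ ∕ X⁻¹ inputs ride inside `hR`).
HONEST FRAMING: [folklore] finite-dimensional Combes–Thomas bookkeeping over module 80 (which is over the tree's `almostLocal_inverse_decay`) + a coordinate dictionary
+ compositions; `hco` is DISPLAYED — the coercivity of the genuine `Δ_a(U)` on (3.35) (census v17 item 1, N06's; [4] p.226 ∕ Thm 3.11) is NOT proved here and NOT
claimed; print's Thm 3.3 rate (3.42) is NOT claimed — the rate is whatever `(m; B, ρ, Θ, c_V)` allow; nothing of Bałaban's asserted beyond the cited theorems;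
N06 ∕ N10 NOT discharged; K1⁷ NOT closed; counts unmoved (typed 28∕28 · discharged 5∕27); 0 `def`, 0 `sorry`, standard axioms; one finite 𝕋⁴ programme at fixed
ε — R4 closes the conditional finite-𝕋⁴ rung `BalabanLadder.UV` only; the YM mass gap (Clay) is NOT proved by any of this; nothing continuum ∕ ℝ⁴ ∕ OS.

────────────────────────────────────────────────────────────────────────────────────────────────────────────────
v1.1 (APPEND-ONLY; §1–§4 byte-identical; one import added — the lane's module 76 `B13OpsYPencilDeltaALetters`): + §5 ★★★
`rawEntryLetters_toMatrix_GAY_parBY_prodCfg_of_pencil_of_coercive` — §4 at NODE 00's bond averaging letter `parB := parBY i` with the local part's pencil letters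
`hLoc` DISCHARGED BY NAME by 76 §4 `rawEntryLetters_toMatrix_localDeltaA_prodCfg` (`cb = cl = 1` at the matrix units); displayed: the R-station's output `hR`, NODE
00's numerals (76's `c₁ c₂ N_b D c_Q c_{Q*} c_a s`, the station's `CgR CdC r′`, `K₀`), a fibre bound, `0 < R`, `0 < ρ`, ONE dominating constant `B′ ≥ B_Δ` (the
assembled Δ_a constant, written once), and the one form bound `hco`.  (76 §4's `open Classical` elaboration and the G-station's instance-polymorphic `hLoc` agree
on the global `DecidableEq (FBondY i)` instance — the composition is literal, no bridge.)
v1.2 (APPEND-ONLY; §1–§5 byte-identical; imports `B9Thm311PosAtRecordV4` (dag-n06-j) and `B9Thm311CoercivePureGaugeAtLettersY` (`exists_pos_coer_of_posDefTr`: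
`PosDefTr w T ⟹ ∃ γ > 0, γ·trIP w Φ Φ ≤ trIP w Φ (TΦ)`, CITED) added): + §6 THE QUALITATIVE KNIT TO ROW 17's ONE CLAUSE — ★ A6 `exists_coercive_deltaAY_parSymY_one`
(the displayed `hco` is INHABITED at the record's v4 letters at `U = 1`, from `posDefTr_deltaAY_parSymY_one`), ★★★ `exists_rawEntryLetters_toMatrix_GAY_prodCfg_of_posDefTr`
(row 17's clause `PosDefTr w (Δ_a(U₀))` + Δ_a's pencil letters ⟹ G's pencil letters at SOME positive rate and radius — N06 content = row 17's one clause, by name),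
`exists_rawEntryLetters_toMatrix_GAY_parBY_prodCfg_of_pencil_of_posDefTr` (the same at the record, §5's binder set with the clause in place of `(m, hco, κ, ρ′)`).

References: T. Bałaban, CMP 99 (1985) 389–434 [Balaban1985BackgroundPropagators] (3.26)–(3.27) p.395, Thm 3.3 p.399, Thm 3.4 p.400, (3.84)–(3.86) p.407, Thm 3.10
(3.107)–(3.108) pp.415–416, Thm 3.11 p.416; CMP 96 (1984) 223–250 [Balaban1984PropagatorsII] (2.19) and p.226, Lemma 2.1 (2.61) p.234; CMP 116 (1988) 1–22
[Balaban1988RG2Cluster] (2.5)–(2.7) pp.12–13, p.15; J.-M. Combes, L. Thomas, CMP 34 (1973) 251–270 [CombesThomas1973]; M. Aizenman, S. Warzel, *Random Operators*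
(AMS 2015) §10.3 [AizenmanWarzel2015].
DOC-ONLY EDITION (dag-n10-w2 g4, 2026-08-28): [B9] page locators corrected per the page owner lit-balaban-r06 — (3.25) p.394; (3.48) p.398; (3.60)–(3.65) p.402,
(3.66)–(3.68) p.403, (3.69)–(3.70) p.404, (3.71)–(3.72) p.405; (3.84)–(3.86) p.407 only; every declaration byte-identical to the previous edition.
-/

noncomputable section

namespace Literature.MathematicalPhysics.QuantumFieldTheory.Balaban1983to89.B13GreenCentreDecayOfCoercive

open Metric Set Finset Module
open scoped Matrix Matrix.Norms.L2Operator ComplexConjugate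
open Literature.MathematicalPhysics.QuantumFieldTheory.Balaban1983to89
open Literature.MathematicalPhysics.QuantumFieldTheory.Balaban1983to89.B9Thm37GlueTorus (tdist1 tdist1_self tdist1_comm tdist1_triangle tdist1_nonneg)
open Literature.MathematicalPhysics.QuantumFieldTheory.Balaban1983to89.B5TorusCover (UT)
open Literature.MathematicalPhysics.QuantumFieldTheory.Balaban1983to89.B9Thm311ReadingCoords (trIP)
open Literature.MathematicalPhysics.QuantumFieldTheory.Balaban1983to89.B9Thm31SiteGpBoundsReg335Y (isUnit_of_coercive)
open Literature.MathematicalPhysics.QuantumFieldTheory.Balaban1983to89.B13EntrywiseWalks (RawEntryLetters)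
open Literature.MathematicalPhysics.QuantumFieldTheory.Balaban1983to89.B13EntryLetterAlgebra (rawEntryLetters_mono sum_fiber_le)
open Literature.MathematicalPhysics.QuantumFieldTheory.Balaban1983to89.B13InverseOperatorCoordinates
  (piProdBasis_repr toMatrix_ringInverse rawEntryLetters_toMatrix_GAY_prodCfg_located)
open Literature.MathematicalPhysics.QuantumFieldTheory.Balaban1983to89.B13MatrixUnitBasisNumerals (stdBasis_repr_apply norm_stdBasis_repr_le norm_stdBasis_le_one)
open Literature.MathematicalPhysics.QuantumFieldTheory.Balaban1983to89.B13InverseDecayWeightedPairing (inverse_decay_of_expDecay_weighted)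
open Literature.MathematicalPhysics.QuantumFieldTheory.Balaban1983to89.B13OpsYPencilGreen (rawEntryLetters_toMatrix_deltaAY_prodCfg)
open Literature.MathematicalPhysics.QuantumFieldTheory.Balaban1983to89.B13OpsYPencilDeltaALetters (rawEntryLetters_toMatrix_localDeltaA_prodCfg)
open Literature.MathematicalPhysics.QuantumFieldTheory.Balaban1983to89.B15DeterminingSets (embIter)
open Literature.MathematicalPhysics.QuantumFieldTheory.Balaban1983to89.B9Thm311ReadingCoords (PosDefTr)
open Literature.MathematicalPhysics.QuantumFieldTheory.Balaban1983to89.B9Thm311PosAtRecordV4 (posDefTr_deltaAY_parSymY_one)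
open Literature.MathematicalPhysics.QuantumFieldTheory.Balaban1983to89.B9Thm311CoercivePureGaugeAtLettersY (exists_pos_coer_of_posDefTr)
open Literature.MathematicalPhysics.QuantumFieldTheory.Balaban1983to89.NodeOLettersSqrtExpDecay (exists_uniform_rate)
open Literature.MathematicalPhysics.QuantumFieldTheory.Balaban1983to89.B13InverseLettersNeumannRadius (thinRadius_pos)
open Literature.MathematicalPhysics.QuantumFieldTheory.Balaban1983to89.B6RandomWalk (c0_nonneg)
open Literature.MathematicalPhysics.QuantumFieldTheory.Balaban1983to89.B9Eq39Adjoint (prodCfg)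
open Literature.MathematicalPhysics.QuantumFieldTheory.Balaban1983to89.B9Eq369Product (prodCfg_zero)
open Literature.MathematicalPhysics.QuantumFieldTheory.Balaban1983to89.B6GlobalChartV1 (PV)
open Literature.MathematicalPhysics.QuantumFieldTheory.Balaban1983to89.B6KLevelCensusIndexV1 (KIdx)
open Literature.MathematicalPhysics.QuantumFieldTheory.Balaban1983to89.Node00

/-! ## §1. The dictionary: the `w`-weighted flat form of the product-basis matrix IS the weighted trace pairing `trIP w` (any finite index type `S`) -/

section Dictionary

variable {S : Type} [Fintype S] [DecidableEq S] {N : ℕ}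

omit [DecidableEq S] in
/-- the `B′`-coordinates of a field `g : S → M_N(ℂ)` are its matrix entries: `B′.repr g (s,(a,b)) = g s a b`. [folklore]
[cite: Balaban1985BackgroundPropagators, (3.107) p.416 (kernels indexed by lattice points and matrix entries), dictionary] -/
theorem piStd_repr_apply (g : S → Matrix (Fin N) (Fin N) ℂ) (p : S × (Fin N × Fin N)) :
    ((Pi.basis fun _ : S => Matrix.stdBasis ℂ (Fin N) (Fin N)).reindex (Equiv.sigmaEquivProd S (Fin N × Fin N))).repr g p = g p.1 p.2.1 p.2.2 := by
  obtain ⟨s, a, b⟩ := p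
  rw [piProdBasis_repr, stdBasis_repr_apply]

omit [DecidableEq S] in
/-- the field with prescribed coordinates `v`: `g s a b := v (s,(a,b))` has `B′.repr g = v`. [folklore]
[cite: Balaban1985BackgroundPropagators, (3.107) p.416, dictionary] -/
theorem coe_piStd_repr_of (v : S × (Fin N × Fin N) → ℂ) :
    ⇑(((Pi.basis fun _ : S => Matrix.stdBasis ℂ (Fin N) (Fin N)).reindex (Equiv.sigmaEquivProd S (Fin N × Fin N))).repr
        (fun s => Matrix.of fun a b => v (s, (a, b)))) = v := by
  funext p
  rw [piStd_repr_apply]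
  rfl

/-- `Re(z̄ z) = |z|²`. [folklore] -/
private theorem re_star_mul_self (z : ℂ) : (star z * z).re = ‖z‖ ^ 2 := by
  rw [Complex.star_def, Complex.conj_mul', ← Complex.ofReal_pow, Complex.ofReal_re]

/-- ★ **THE WEIGHTED FORM OF THE MATRIX IS THE WEIGHTED TRACE PAIRING**: for `Φ : Module.End ℂ (S → M_N(ℂ))`, a weight `w : S → ℝ` and the field `g` with
coordinates `v`, `Re Σ_p w(p.1)·v̄_p·(toMatrix B′ B′ Φ · v)_p = trIP w g (Φ g)` — print's scalar products of `𝔤`-valued site ∕ bond ∕ block functions read in the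
product basis. [cite: Balaban1985BackgroundPropagators, p.393 (scalar products), (3.107) p.416; Balaban1984PropagatorsII, (2.69) p.235, dictionary] -/
theorem weightedForm_toMatrix_eq_trIP (w : S → ℝ) (Φ : Module.End ℂ (S → Matrix (Fin N) (Fin N) ℂ)) (v : S × (Fin N × Fin N) → ℂ) :
    (∑ p, (w p.1 : ℂ) * (star (v p) *
        (LinearMap.toMatrix ((Pi.basis fun _ : S => Matrix.stdBasis ℂ (Fin N) (Fin N)).reindex (Equiv.sigmaEquivProd S (Fin N × Fin N)))
          ((Pi.basis fun _ : S => Matrix.stdBasis ℂ (Fin N) (Fin N)).reindex (Equiv.sigmaEquivProd S (Fin N × Fin N))) Φ *ᵥ v) p)).re =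
      trIP w (fun s => Matrix.of fun a b => v (s, (a, b))) (Φ (fun s => Matrix.of fun a b => v (s, (a, b)))) := by
  set g : S → Matrix (Fin N) (Fin N) ℂ := fun s => Matrix.of fun a b => v (s, (a, b)) with hg
  have hv : v = ⇑(((Pi.basis fun _ : S => Matrix.stdBasis ℂ (Fin N) (Fin N)).reindex (Equiv.sigmaEquivProd S (Fin N × Fin N))).repr g) :=
    (coe_piStd_repr_of v).symm
  rw [hv, LinearMap.toMatrix_mulVec_repr, trIP, Complex.re_sum, Fintype.sum_prod_type]
  refine Finset.sum_congr rfl fun s _ => ?_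
  rw [Fintype.sum_prod_type]
  simp only [piStd_repr_apply, Complex.re_ofReal_mul, ← Finset.mul_sum]

omit [DecidableEq S] in
/-- … and the weighted norm square of the coordinates is `trIP w g g`. [cite: Balaban1985BackgroundPropagators, p.393 (scalar products), dictionary] -/
theorem weightedNormSq_eq_trIP (w : S → ℝ) (v : S × (Fin N × Fin N) → ℂ) :
    ∑ p, w p.1 * ‖v p‖ ^ 2 = trIP w (fun s => Matrix.of fun a b => v (s, (a, b))) (fun s => Matrix.of fun a b => v (s, (a, b))) := by
  rw [trIP, Fintype.sum_prod_type]
  refine Finset.sum_congr rfl fun s _ => ?_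
  rw [Fintype.sum_prod_type]
  simp only [Matrix.of_apply, re_star_mul_self, ← Finset.mul_sum]

/-- ★ **A FORM BOUND IN THE TRACE PAIRING IS A WEIGHTED ACCRETIVITY OF THE MATRIX**: `m·trIP w Ψ Ψ ≤ trIP w Ψ (ΦΨ)` for all `Ψ` (print's «bounded from
below by a positive constant», quantitatively) ⟹ `toMatrix B′ B′ Φ` is `m`-accretive in the `w`-weighted pairing — the hypothesis `hacc` of module 80's
`inverse_decay_of_expDecay_weighted`. [cite: Balaban1985BackgroundPropagators, Thm 3.11 p.416; Balaban1984PropagatorsII, p.226 («Δ_a is bounded from below by a positive constant»), dictionary] -/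
theorem weightedAccretive_toMatrix_of_trIP_coercive (w : S → ℝ) (Φ : Module.End ℂ (S → Matrix (Fin N) (Fin N) ℂ)) {m : ℝ}
    (hco : ∀ Ψ : S → Matrix (Fin N) (Fin N) ℂ, m * trIP w Ψ Ψ ≤ trIP w Ψ (Φ Ψ)) (v : S × (Fin N × Fin N) → ℂ) :
    m * ∑ p, w p.1 * ‖v p‖ ^ 2 ≤
      (∑ p, (w p.1 : ℂ) * (star (v p) *
        (LinearMap.toMatrix ((Pi.basis fun _ : S => Matrix.stdBasis ℂ (Fin N) (Fin N)).reindex (Equiv.sigmaEquivProd S (Fin N × Fin N)))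
          ((Pi.basis fun _ : S => Matrix.stdBasis ℂ (Fin N) (Fin N)).reindex (Equiv.sigmaEquivProd S (Fin N × Fin N))) Φ *ᵥ v) p)).re := by
  rw [weightedNormSq_eq_trIP, weightedForm_toMatrix_eq_trIP]
  exact hco _

end Dictionary

/-! ## §2. ★★ Coercive in the trace pairing + exponentially localised matrix ⟹ a unit with exponentially decaying inverse matrix (any `S`) -/

section Generic

variable {S : Type} [Fintype S] [DecidableEq S] {N : ℕ}
variable {ν : ℕ} {Nf : Fin ν → ℕ} [∀ j, NeZero (Nf j)]

/-- ★★ **COERCIVE ⟹ INVERTIBLE WITH EXPONENTIALLY DECAYING INVERSE MATRIX** (the shape of [B9] Thm 3.3 ∕ 3.10 ∕ 3.11 for `G = Δ_a⁻¹`, and of Thm 3.2 (3.48)).  Let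
`Φ : Module.End ℂ (S → M_N(ℂ))` satisfy the form bound `m·trIP w Ψ Ψ ≤ trIP w Ψ (ΦΨ)` (`m > 0`, weight `w > 0` with ratio numeral `√w s ≤ Θ·√w t`), and let its
product-basis matrix decay: `‖toMatrix B′ B′ Φ p q‖ ≤ a·e^{−κ₀ d₁(loc p, loc q)}` through a location map `loc` into a torus, with half-rate volume sums `≤ c_V`.  Then `Φ` is a
unit (n06-w1's `isUnit_of_coercive`) and for every rate `0 ≤ κ ≤ κ₀∕4` with `8(Θa)κc_V ≤ mκ₀`: `‖toMatrix B′ B′ (Ring.inverse Φ) p q‖ ≤ Θ·(4∕m)·e^{−κ d₁(loc p, loc q)}`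
(module 80's weighted Combes–Thomas theorem through §1's dictionary and `toMatrix_ringInverse`).
[cite: Balaban1985BackgroundPropagators, (3.27) p.395, Thm 3.3 p.399, Thm 3.10 (3.108) p.416, Thm 3.11 p.416; Balaban1984PropagatorsII, p.226, Lemma 2.1 (2.61) p.234;
Balaban1988RG2Cluster, (2.7) p.13; AizenmanWarzel2015, §10.3 (Combes–Thomas estimate)] -/
theorem isUnit_and_norm_toMatrix_ringInverse_le_of_trIP_coercive (w : S → ℝ) (hw : ∀ s, 0 < w s)
    {Θ : ℝ} (hΘ : ∀ s t : S, Real.sqrt (w s) ≤ Θ * Real.sqrt (w t))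
    (Φ : Module.End ℂ (S → Matrix (Fin N) (Fin N) ℂ)) {m : ℝ} (hm : 0 < m)
    (hco : ∀ Ψ : S → Matrix (Fin N) (Fin N) ℂ, m * trIP w Ψ Ψ ≤ trIP w Ψ (Φ Ψ))
    (loc : S × (Fin N × Fin N) → UT Nf) {a κ₀ : ℝ} (ha : 0 ≤ a) (hκ₀ : 0 < κ₀)
    (hdec : ∀ p q, ‖LinearMap.toMatrix
        ((Pi.basis fun _ : S => Matrix.stdBasis ℂ (Fin N) (Fin N)).reindex (Equiv.sigmaEquivProd S (Fin N × Fin N)))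
        ((Pi.basis fun _ : S => Matrix.stdBasis ℂ (Fin N) (Fin N)).reindex (Equiv.sigmaEquivProd S (Fin N × Fin N))) Φ p q‖ ≤
          a * Real.exp (-(κ₀ * tdist1 Nf (loc p) (loc q))))
    {cV : ℝ} (hvol : ∀ p, ∑ q, Real.exp (-(κ₀ / 2 * tdist1 Nf (loc p) (loc q))) ≤ cV)
    (hvol' : ∀ q, ∑ p, Real.exp (-(κ₀ / 2 * tdist1 Nf (loc p) (loc q))) ≤ cV)
    {κ : ℝ} (hκ : 0 ≤ κ) (hκ4 : κ ≤ κ₀ / 4) (hκm : 8 * (Θ * a) * κ * cV ≤ m * κ₀) :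
    IsUnit Φ ∧
      ∀ p q, ‖LinearMap.toMatrix
          ((Pi.basis fun _ : S => Matrix.stdBasis ℂ (Fin N) (Fin N)).reindex (Equiv.sigmaEquivProd S (Fin N × Fin N)))
          ((Pi.basis fun _ : S => Matrix.stdBasis ℂ (Fin N) (Fin N)).reindex (Equiv.sigmaEquivProd S (Fin N × Fin N))) (Ring.inverse Φ) p q‖ ≤
        Θ * (4 / m) * Real.exp (-(κ * tdist1 Nf (loc p) (loc q))) := by
  refine ⟨isUnit_of_coercive hw hm hco, fun p q => ?_⟩
  have h80 := inverse_decay_of_expDecay_weighted (fun p q : S × (Fin N × Fin N) => tdist1 Nf (loc p) (loc q))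
    (fun p => tdist1_self (loc p)) (fun p q => tdist1_comm (loc p) (loc q)) (fun p q r => tdist1_triangle (loc p) (loc q) (loc r))
    (fun p q => tdist1_nonneg (loc p) (loc q)) (fun p : S × (Fin N × Fin N) => w p.1) (fun p => hw p.1) (fun p q => hΘ p.1 q.1)
    (LinearMap.toMatrix
        ((Pi.basis fun _ : S => Matrix.stdBasis ℂ (Fin N) (Fin N)).reindex (Equiv.sigmaEquivProd S (Fin N × Fin N)))
        ((Pi.basis fun _ : S => Matrix.stdBasis ℂ (Fin N) (Fin N)).reindex (Equiv.sigmaEquivProd S (Fin N × Fin N))) Φ)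
    hm ha hκ₀ hκ hκ4 hκm (weightedAccretive_toMatrix_of_trIP_coercive w Φ hco) hdec hvol hvol'
  rw [toMatrix_ringInverse]
  exact h80.2 p q

/-- **… IN THE FLAT PAIRING** (`w = 1`, so `Θ = 1`): `m·trIP 1 Ψ Ψ ≤ trIP 1 Ψ (ΦΨ)` + entry decay `(a, κ₀)` + volume sums ⟹ `IsUnit Φ ∧ ‖toMatrix B′ B′ (Ring.inverse Φ) p q‖ ≤
(4∕m)·e^{−κ d₁}` for `0 ≤ κ ≤ κ₀∕4`, `8aκc_V ≤ mκ₀` — the currency of row 17's one clause (`PosDefTr 1`).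
[cite: Balaban1985BackgroundPropagators, Thm 3.3 p.399, Thm 3.10 (3.108) p.416, Thm 3.11 p.416; Balaban1984PropagatorsII, p.226; AizenmanWarzel2015, §10.3] -/
theorem isUnit_and_norm_toMatrix_ringInverse_le_of_trIP_coercive_flat
    (Φ : Module.End ℂ (S → Matrix (Fin N) (Fin N) ℂ)) {m : ℝ} (hm : 0 < m)
    (hco : ∀ Ψ : S → Matrix (Fin N) (Fin N) ℂ, m * trIP (fun _ => (1 : ℝ)) Ψ Ψ ≤ trIP (fun _ => (1 : ℝ)) Ψ (Φ Ψ))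
    (loc : S × (Fin N × Fin N) → UT Nf) {a κ₀ : ℝ} (ha : 0 ≤ a) (hκ₀ : 0 < κ₀)
    (hdec : ∀ p q, ‖LinearMap.toMatrix
        ((Pi.basis fun _ : S => Matrix.stdBasis ℂ (Fin N) (Fin N)).reindex (Equiv.sigmaEquivProd S (Fin N × Fin N)))
        ((Pi.basis fun _ : S => Matrix.stdBasis ℂ (Fin N) (Fin N)).reindex (Equiv.sigmaEquivProd S (Fin N × Fin N))) Φ p q‖ ≤
          a * Real.exp (-(κ₀ * tdist1 Nf (loc p) (loc q))))
    {cV : ℝ} (hvol : ∀ p, ∑ q, Real.exp (-(κ₀ / 2 * tdist1 Nf (loc p) (loc q))) ≤ cV)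
    (hvol' : ∀ q, ∑ p, Real.exp (-(κ₀ / 2 * tdist1 Nf (loc p) (loc q))) ≤ cV)
    {κ : ℝ} (hκ : 0 ≤ κ) (hκ4 : κ ≤ κ₀ / 4) (hκm : 8 * a * κ * cV ≤ m * κ₀) :
    IsUnit Φ ∧
      ∀ p q, ‖LinearMap.toMatrix
          ((Pi.basis fun _ : S => Matrix.stdBasis ℂ (Fin N) (Fin N)).reindex (Equiv.sigmaEquivProd S (Fin N × Fin N)))
          ((Pi.basis fun _ : S => Matrix.stdBasis ℂ (Fin N) (Fin N)).reindex (Equiv.sigmaEquivProd S (Fin N × Fin N))) (Ring.inverse Φ) p q‖ ≤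
        4 / m * Real.exp (-(κ * tdist1 Nf (loc p) (loc q))) := by
  have hΘ : ∀ s t : S, Real.sqrt ((fun _ : S => (1 : ℝ)) s) ≤ 1 * Real.sqrt ((fun _ : S => (1 : ℝ)) t) := fun _ _ => by rw [one_mul]
  have h := isUnit_and_norm_toMatrix_ringInverse_le_of_trIP_coercive (fun _ : S => (1 : ℝ)) (fun _ => one_pos) hΘ Φ hm hco loc ha hκ₀ hdec
    hvol hvol' hκ hκ4 (by rwa [one_mul])
  refine ⟨h.1, fun p q => ?_⟩
  have h2 := h.2 p q
  rwa [one_mul] at h2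

/-- ★★ **§2 WITH THE VOLUME NUMERAL DISCHARGED** by a fibre bound `m_F` of the location map (`c_V = m_F·c₀(1,κ₀∕2)^ν`, every torus; the two half-rate sums
are `B13EntryLetterAlgebra.sum_fiber_le` + `B13LocalKernelWalks.rowSum_torus` inline — the same two calls module 81 §4 names `halfRate_rowSum∕colSum_le_of_fibre`).
[cite: Balaban1985BackgroundPropagators, Thm 3.3 p.399, Thm 3.10 (3.108) p.416, Thm 3.11 p.416; Balaban1984PropagatorsII, p.226, Lemma 2.1 (2.61) p.234; AizenmanWarzel2015, §10.3] -/
theorem isUnit_and_norm_toMatrix_ringInverse_le_of_trIP_coercive_fibre (w : S → ℝ) (hw : ∀ s, 0 < w s)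
    {Θ : ℝ} (hΘ : ∀ s t : S, Real.sqrt (w s) ≤ Θ * Real.sqrt (w t))
    (Φ : Module.End ℂ (S → Matrix (Fin N) (Fin N) ℂ)) {m : ℝ} (hm : 0 < m)
    (hco : ∀ Ψ : S → Matrix (Fin N) (Fin N) ℂ, m * trIP w Ψ Ψ ≤ trIP w Ψ (Φ Ψ))
    (loc : S × (Fin N × Fin N) → UT Nf) {mF : ℕ} (hfib : ∀ y : UT Nf, (univ.filter fun k => loc k = y).card ≤ mF)
    {a κ₀ : ℝ} (ha : 0 ≤ a) (hκ₀ : 0 < κ₀)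
    (hdec : ∀ p q, ‖LinearMap.toMatrix
        ((Pi.basis fun _ : S => Matrix.stdBasis ℂ (Fin N) (Fin N)).reindex (Equiv.sigmaEquivProd S (Fin N × Fin N)))
        ((Pi.basis fun _ : S => Matrix.stdBasis ℂ (Fin N) (Fin N)).reindex (Equiv.sigmaEquivProd S (Fin N × Fin N))) Φ p q‖ ≤
          a * Real.exp (-(κ₀ * tdist1 Nf (loc p) (loc q))))
    {κ : ℝ} (hκ : 0 ≤ κ) (hκ4 : κ ≤ κ₀ / 4) (hκm : 8 * (Θ * a) * κ * (mF * B6.c0 1 (κ₀ / 2) ^ ν) ≤ m * κ₀) :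
    IsUnit Φ ∧
      ∀ p q, ‖LinearMap.toMatrix
          ((Pi.basis fun _ : S => Matrix.stdBasis ℂ (Fin N) (Fin N)).reindex (Equiv.sigmaEquivProd S (Fin N × Fin N)))
          ((Pi.basis fun _ : S => Matrix.stdBasis ℂ (Fin N) (Fin N)).reindex (Equiv.sigmaEquivProd S (Fin N × Fin N))) (Ring.inverse Φ) p q‖ ≤
        Θ * (4 / m) * Real.exp (-(κ * tdist1 Nf (loc p) (loc q))) := by
  -- half-rate row ∕ column volume sums through `loc`: fibre bound × the torus row sum
  have hrow : ∀ p : S × (Fin N × Fin N), ∑ q, Real.exp (-(κ₀ / 2 * tdist1 Nf (loc p) (loc q))) ≤ mF * B6.c0 1 (κ₀ / 2) ^ ν := by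
    intro p
    have ht : ∑ z : UT Nf, Real.exp (-(κ₀ / 2 * tdist1 Nf (loc p) z)) ≤ B6.c0 1 (κ₀ / 2) ^ ν :=
      B13LocalKernelWalks.rowSum_torus Nf (half_pos hκ₀) (loc p)
    exact (sum_fiber_le hfib (f := fun y => Real.exp (-(κ₀ / 2 * tdist1 Nf (loc p) y))) fun _ => Real.exp_nonneg _).trans
      (mul_le_mul_of_nonneg_left ht (Nat.cast_nonneg _))
  have hcol : ∀ q : S × (Fin N × Fin N), ∑ p, Real.exp (-(κ₀ / 2 * tdist1 Nf (loc p) (loc q))) ≤ mF * B6.c0 1 (κ₀ / 2) ^ ν := fun q =>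
    le_trans (le_of_eq (Finset.sum_congr rfl fun p _ => by rw [tdist1_comm])) (hrow q)
  exact isUnit_and_norm_toMatrix_ringInverse_le_of_trIP_coercive w hw hΘ Φ hm hco loc ha hκ₀ hdec hrow hcol hκ hκ4 hκm

end Generic

/-! ## §3. ★★★ At NODE 00's `Δ_a(U) ∕ G(U) = Δ_a(U)⁻¹` on the bond sector: the G-junction's N06 pair `(hU, hG)` from ONE form bound -/

section Bond

variable {d ℓ : ℕ} {hd : 1 ≤ d + 1} {hL : Odd (ℓ + 1) ∧ 1 < ℓ + 1} {b₀ b₁ : ℝ}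
variable (i : KIdx d ℓ hd hL b₀ b₁) {N : ℕ}
variable {ν : ℕ} {Nf : Fin ν → ℕ} [∀ j, NeZero (Nf j)]

/-- ★★ **THE G-JUNCTION's TWO N06 INPUTS FROM ONE FORM BOUND.**  For ANY letters `parS parB Gp` and EVERY background `U₀` of NODE 00's bond sector (`𝔸 = M_N(ℂ)`):
if `Δ_a(U₀) = deltaAY i parS parB Gp U₀` is coercive in the `w`-weighted trace pairing, `m·trIP w Ψ Ψ ≤ trIP w Ψ (Δ_a(U₀)Ψ)` (DISPLAYED — Theorem 3.11's «Δ_a positive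
definite» ∕ [4] p.226 «bounded from below by a positive constant», quantitatively; the bond-sector twin of n06-w1's `trIP_deltaPrimeAY_parSymY_ge`, NOT proved here), and
its product-basis matrix decays (`(a, κ₀)` through `loc`, volume sums `≤ c_V`), then `IsUnit (Δ_a(U₀))` AND `‖toMatrix B′ B′ (G(U₀)) p q‖ ≤ Θ·(4∕m)·e^{−κ d₁(loc p, loc q)}`
for `0 ≤ κ ≤ κ₀∕4`, `8(Θa)κc_V ≤ mκ₀` — EXACTLY the pair `(hU, hG)` displayed by `B13InverseOperatorCoordinates.rawEntryLetters_toMatrix_GAY_prodCfg_located`.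
[cite: Balaban1985BackgroundPropagators, (3.26)–(3.27) p.395, Thm 3.3 p.399, Thm 3.10 (3.107)–(3.108) pp.415–416, Thm 3.11 p.416; Balaban1984PropagatorsII, (2.19) and p.226;
AizenmanWarzel2015, §10.3] -/
theorem isUnit_deltaAY_and_norm_toMatrix_GAY_le_of_coercive (parS : SiteParY (Matrix (Fin N) (Fin N) ℂ) i)
    (parB : BondParY (Matrix (Fin N) (Fin N) ℂ) i) (Gp : SiteOpY (Matrix (Fin N) (Fin N) ℂ) i) (U₀ : CfgY (Matrix (Fin N) (Fin N) ℂ) i)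
    (w : FBondY i → ℝ) (hw : ∀ s, 0 < w s) {Θ : ℝ} (hΘ : ∀ s t : FBondY i, Real.sqrt (w s) ≤ Θ * Real.sqrt (w t)) {m : ℝ} (hm : 0 < m)
    (hco : ∀ Ψ : FBondY i → Matrix (Fin N) (Fin N) ℂ, m * trIP w Ψ Ψ ≤ trIP w Ψ (deltaAY i parS parB Gp U₀ Ψ))
    (loc : FBondY i × (Fin N × Fin N) → UT Nf) {a κ₀ : ℝ} (ha : 0 ≤ a) (hκ₀ : 0 < κ₀)
    (hdec : ∀ p q, ‖LinearMap.toMatrix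
        ((Pi.basis fun _ : FBondY i => Matrix.stdBasis ℂ (Fin N) (Fin N)).reindex (Equiv.sigmaEquivProd (FBondY i) (Fin N × Fin N)))
        ((Pi.basis fun _ : FBondY i => Matrix.stdBasis ℂ (Fin N) (Fin N)).reindex (Equiv.sigmaEquivProd (FBondY i) (Fin N × Fin N)))
        (deltaAY i parS parB Gp U₀) p q‖ ≤ a * Real.exp (-(κ₀ * tdist1 Nf (loc p) (loc q))))
    {cV : ℝ} (hvol : ∀ p, ∑ q, Real.exp (-(κ₀ / 2 * tdist1 Nf (loc p) (loc q))) ≤ cV)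
    (hvol' : ∀ q, ∑ p, Real.exp (-(κ₀ / 2 * tdist1 Nf (loc p) (loc q))) ≤ cV)
    {κ : ℝ} (hκ : 0 ≤ κ) (hκ4 : κ ≤ κ₀ / 4) (hκm : 8 * (Θ * a) * κ * cV ≤ m * κ₀) :
    IsUnit (deltaAY i parS parB Gp U₀) ∧
      ∀ p q, ‖LinearMap.toMatrix
          ((Pi.basis fun _ : FBondY i => Matrix.stdBasis ℂ (Fin N) (Fin N)).reindex (Equiv.sigmaEquivProd (FBondY i) (Fin N × Fin N)))
          ((Pi.basis fun _ : FBondY i => Matrix.stdBasis ℂ (Fin N) (Fin N)).reindex (Equiv.sigmaEquivProd (FBondY i) (Fin N × Fin N)))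
          (GAY i parS parB Gp U₀) p q‖ ≤
        Θ * (4 / m) * Real.exp (-(κ * tdist1 Nf (loc p) (loc q))) :=
  isUnit_and_norm_toMatrix_ringInverse_le_of_trIP_coercive w hw hΘ (deltaAY i parS parB Gp U₀) hm hco loc ha hκ₀ hdec hvol hvol' hκ hκ4 hκm

/-- **A PENCIL-LETTER DATUM READ AT THE CENTRE**: `RawEntryLetters F loc R ρ B` with `0 < R` gives the entry decay of `F 0` at rate `ρ` with constant `B` (the centre
`0` lies in the chart ball). [cite: Balaban1985BackgroundPropagators, Thm 3.4 p.400 («The extended operators satisfy all the inequalities of Theorems 3.1–3.3»), (3.108) p.416] -/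
theorem entryDecay_centre_of_rawEntryLetters {E : Type*} [NormedAddCommGroup E] [NormedSpace ℂ E] {P : Type} [Fintype P] [DecidableEq P]
    {F : E → Matrix P P ℂ} {loc : P → UT Nf} {R ρ B : ℝ} (h : RawEntryLetters F loc R ρ B) (hR : 0 < R) (p q : P) :
    ‖F 0 p q‖ ≤ B * Real.exp (-(ρ * tdist1 Nf (loc p) (loc q))) :=
  h.decay 0 (mem_ball_self hR) p q

/-- ★★★ **THE G-JUNCTION, THIN RADIUS LOCATED, WITH N06's CONTENT REDUCED TO ONE FORM BOUND.**  Inputs: (i) the letters `hA : RawEntryLetters (A′ ↦ toMatrix B′ B′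
(Δ_a(e^{iηA′}U₀))) loc R ρ B` of NODE 00's `Δ_a` along pv27's pencil (the junction's own datum — the lane's local part + the `D R D*` station; `0 < R`, `0 < ρ`); (ii) the
DISPLAYED form bound `hco : m·trIP w Ψ Ψ ≤ trIP w Ψ (Δ_a(U₀)Ψ)` (`m > 0`, `w > 0`, ratio numeral `Θ ≥ 0`) — Theorem 3.11 ∕ [4] p.226 for `Δ_a(U₀)`, quantitatively, N06's;
(iii) a fibre bound `m_F` of `loc`; (iv) a rate `0 ≤ κ ≤ ρ∕4` with `8(ΘB)κ(m_F c₀(1,ρ∕2)^ν) ≤ mρ` and a target `0 ≤ ρ′ < κ`.  Conclusion: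
`RawEntryLetters (A′ ↦ toMatrix B′ B′ (G(e^{iηA′}U₀))) loc R₁⋆ ρ′ (2Θ(4∕m))` at the located radius `R₁⋆ = R∕(4·B·(Θ(4∕m))·(m_F c₀(1,(κ−ρ′)∕3)^ν)² + 1)`: the centre inputs
`IsUnit (Δ_a(U₀))` + decay of `toMatrix (G(U₀))` of `…GAY_prodCfg_located` are §3's theorem fed by `hA` READ AT `A′ = 0` (`prodCfg_zero`).  No unitarity, no (3.35) used here —
they live inside whoever discharges `hco`.
[cite: Balaban1985BackgroundPropagators, (3.26)–(3.27) p.395, Thm 3.3 p.399, Thm 3.4 p.400, (3.84)–(3.86) p.407, Thm 3.10 (3.107)–(3.108) pp.415–416, Thm 3.11 p.416;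
Balaban1984PropagatorsII, p.226, Lemma 2.1 (2.61) p.234; Balaban1988RG2Cluster, (2.5)–(2.7) pp.12–13, p.15; AizenmanWarzel2015, §10.3] -/
theorem rawEntryLetters_toMatrix_GAY_prodCfg_located_of_coercive (parS : SiteParY (Matrix (Fin N) (Fin N) ℂ) i)
    (parB : BondParY (Matrix (Fin N) (Fin N) ℂ) i) (Gp : SiteOpY (Matrix (Fin N) (Fin N) ℂ) i) (U₀ : CfgY (Matrix (Fin N) (Fin N) ℂ) i) (η : ℝ)
    {loc : FBondY i × (Fin N × Fin N) → UT Nf} {R ρ B : ℝ}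
    (hA : RawEntryLetters (fun a : Fin (d + 1) → Site (PV d ℓ i.m i.K hd hL) 0 → Matrix (Fin N) (Fin N) ℂ =>
      LinearMap.toMatrix
        ((Pi.basis fun _ : FBondY i => Matrix.stdBasis ℂ (Fin N) (Fin N)).reindex (Equiv.sigmaEquivProd (FBondY i) (Fin N × Fin N)))
        ((Pi.basis fun _ : FBondY i => Matrix.stdBasis ℂ (Fin N) (Fin N)).reindex (Equiv.sigmaEquivProd (FBondY i) (Fin N × Fin N)))
        (deltaAY i parS parB Gp (prodCfg U₀ η a))) loc R ρ B)
    (hR : 0 < R) (hρ : 0 < ρ)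
    (w : FBondY i → ℝ) (hw : ∀ s, 0 < w s) {Θ : ℝ} (hΘ0 : 0 ≤ Θ) (hΘ : ∀ s t : FBondY i, Real.sqrt (w s) ≤ Θ * Real.sqrt (w t))
    {m : ℝ} (hm : 0 < m)
    (hco : ∀ Ψ : FBondY i → Matrix (Fin N) (Fin N) ℂ, m * trIP w Ψ Ψ ≤ trIP w Ψ (deltaAY i parS parB Gp U₀ Ψ))
    {mF : ℕ} (hfib : ∀ y : UT Nf, (univ.filter fun k => loc k = y).card ≤ mF)
    {κ : ℝ} (hκ : 0 ≤ κ) (hκ4 : κ ≤ ρ / 4) (hκm : 8 * (Θ * B) * κ * (mF * B6.c0 1 (ρ / 2) ^ ν) ≤ m * ρ)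
    {ρ' : ℝ} (hρ'0 : 0 ≤ ρ') (hρ' : ρ' < κ) :
    RawEntryLetters (fun a : Fin (d + 1) → Site (PV d ℓ i.m i.K hd hL) 0 → Matrix (Fin N) (Fin N) ℂ =>
        LinearMap.toMatrix
          ((Pi.basis fun _ : FBondY i => Matrix.stdBasis ℂ (Fin N) (Fin N)).reindex (Equiv.sigmaEquivProd (FBondY i) (Fin N × Fin N)))
          ((Pi.basis fun _ : FBondY i => Matrix.stdBasis ℂ (Fin N) (Fin N)).reindex (Equiv.sigmaEquivProd (FBondY i) (Fin N × Fin N)))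
          (GAY i parS parB Gp (prodCfg U₀ η a))) loc
      (R / (4 * (B * (Θ * (4 / m)) * (mF * B6.c0 1 ((κ - ρ') / 3) ^ ν) * (mF * B6.c0 1 ((κ - ρ') / 3) ^ ν)) + 1)) ρ' (2 * (Θ * (4 / m))) := by
  -- the centre: `hA` at `A′ = 0` is the entry decay of `toMatrix (Δ_a(U₀))` (rate `ρ`, constant `B`)
  have hdec : ∀ p q, ‖LinearMap.toMatrix
      ((Pi.basis fun _ : FBondY i => Matrix.stdBasis ℂ (Fin N) (Fin N)).reindex (Equiv.sigmaEquivProd (FBondY i) (Fin N × Fin N)))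
      ((Pi.basis fun _ : FBondY i => Matrix.stdBasis ℂ (Fin N) (Fin N)).reindex (Equiv.sigmaEquivProd (FBondY i) (Fin N × Fin N)))
      (deltaAY i parS parB Gp U₀) p q‖ ≤ B * Real.exp (-(ρ * tdist1 Nf (loc p) (loc q))) := by
    intro p q
    have h := entryDecay_centre_of_rawEntryLetters hA hR p q
    rwa [prodCfg_zero] at h
  -- §3: the two centre inputs from `hco`
  obtain ⟨hU, hG⟩ := isUnit_and_norm_toMatrix_ringInverse_le_of_trIP_coercive_fibre w hw hΘ (deltaAY i parS parB Gp U₀) hm hco loc hfib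
    hA.B_nonneg hρ hdec hκ hκ4 hκm
  -- the constant `Θ(4∕m)` of `hG` is nonnegative
  have hBG : 0 ≤ Θ * (4 / m) := mul_nonneg hΘ0 (div_nonneg (by norm_num) hm.le)
  exact rawEntryLetters_toMatrix_GAY_prodCfg_located i (Matrix.stdBasis ℂ (Fin N) (Fin N)) parS parB Gp U₀ η
    (rawEntryLetters_mono hA le_rfl (hκ4.trans (by linarith)) le_rfl) hU hG hBG hfib hR hρ'0 hρ'

/-- **… IN THE FLAT PAIRING** (`w = 1`, `Θ = 1` — the currency of row 17's one clause `PosDefTr 1 (Δ_a(U))` and of n06-w1's site-sector `trIP_deltaPrimeAY_parSymY_ge`):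
`hA` + `hco : m·trIP 1 Ψ Ψ ≤ trIP 1 Ψ (Δ_a(U₀)Ψ)` + fibre bound + `κ ≤ ρ∕4`, `8Bκ(m_F c₀(1,ρ∕2)^ν) ≤ mρ`, `0 ≤ ρ′ < κ` ⟹
`RawEntryLetters (A′ ↦ toMatrix B′ B′ (G(e^{iηA′}U₀))) loc (R∕(4·B·(4∕m)·(m_F c₀(1,(κ−ρ′)∕3)^ν)² + 1)) ρ′ (2(4∕m))`.
[cite: Balaban1985BackgroundPropagators, (3.26)–(3.27) p.395, Thm 3.3 p.399, Thm 3.4 p.400, (3.84)–(3.86) p.407, Thm 3.10 (3.108) p.416, Thm 3.11 p.416;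
Balaban1984PropagatorsII, p.226, Lemma 2.1 (2.61) p.234; Balaban1988RG2Cluster, (2.5)–(2.7) pp.12–13; AizenmanWarzel2015, §10.3] -/
theorem rawEntryLetters_toMatrix_GAY_prodCfg_located_of_coercive_flat (parS : SiteParY (Matrix (Fin N) (Fin N) ℂ) i)
    (parB : BondParY (Matrix (Fin N) (Fin N) ℂ) i) (Gp : SiteOpY (Matrix (Fin N) (Fin N) ℂ) i) (U₀ : CfgY (Matrix (Fin N) (Fin N) ℂ) i) (η : ℝ)
    {loc : FBondY i × (Fin N × Fin N) → UT Nf} {R ρ B : ℝ}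
    (hA : RawEntryLetters (fun a : Fin (d + 1) → Site (PV d ℓ i.m i.K hd hL) 0 → Matrix (Fin N) (Fin N) ℂ =>
      LinearMap.toMatrix
        ((Pi.basis fun _ : FBondY i => Matrix.stdBasis ℂ (Fin N) (Fin N)).reindex (Equiv.sigmaEquivProd (FBondY i) (Fin N × Fin N)))
        ((Pi.basis fun _ : FBondY i => Matrix.stdBasis ℂ (Fin N) (Fin N)).reindex (Equiv.sigmaEquivProd (FBondY i) (Fin N × Fin N)))
        (deltaAY i parS parB Gp (prodCfg U₀ η a))) loc R ρ B)
    (hR : 0 < R) (hρ : 0 < ρ) {m : ℝ} (hm : 0 < m)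
    (hco : ∀ Ψ : FBondY i → Matrix (Fin N) (Fin N) ℂ,
      m * trIP (fun _ => (1 : ℝ)) Ψ Ψ ≤ trIP (fun _ => (1 : ℝ)) Ψ (deltaAY i parS parB Gp U₀ Ψ))
    {mF : ℕ} (hfib : ∀ y : UT Nf, (univ.filter fun k => loc k = y).card ≤ mF)
    {κ : ℝ} (hκ : 0 ≤ κ) (hκ4 : κ ≤ ρ / 4) (hκm : 8 * B * κ * (mF * B6.c0 1 (ρ / 2) ^ ν) ≤ m * ρ)
    {ρ' : ℝ} (hρ'0 : 0 ≤ ρ') (hρ' : ρ' < κ) :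
    RawEntryLetters (fun a : Fin (d + 1) → Site (PV d ℓ i.m i.K hd hL) 0 → Matrix (Fin N) (Fin N) ℂ =>
        LinearMap.toMatrix
          ((Pi.basis fun _ : FBondY i => Matrix.stdBasis ℂ (Fin N) (Fin N)).reindex (Equiv.sigmaEquivProd (FBondY i) (Fin N × Fin N)))
          ((Pi.basis fun _ : FBondY i => Matrix.stdBasis ℂ (Fin N) (Fin N)).reindex (Equiv.sigmaEquivProd (FBondY i) (Fin N × Fin N)))
          (GAY i parS parB Gp (prodCfg U₀ η a))) loc
      (R / (4 * (B * (4 / m) * (mF * B6.c0 1 ((κ - ρ') / 3) ^ ν) * (mF * B6.c0 1 ((κ - ρ') / 3) ^ ν)) + 1)) ρ' (2 * (4 / m)) := by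
  have hΘ : ∀ s t : FBondY i, Real.sqrt ((fun _ : FBondY i => (1 : ℝ)) s) ≤ 1 * Real.sqrt ((fun _ : FBondY i => (1 : ℝ)) t) :=
    fun _ _ => by rw [one_mul]
  have h := rawEntryLetters_toMatrix_GAY_prodCfg_located_of_coercive i parS parB Gp U₀ η hA hR hρ (fun _ => (1 : ℝ)) (fun _ => one_pos)
    zero_le_one hΘ hm hco hfib hκ hκ4 (by rwa [one_mul]) hρ'0 hρ'
  simpa only [one_mul] using h

end Bond

/-! ## §4. ★★★ The G-station at the record's algebra with the G-step's N06 inputs replaced by the one form bound -/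

section Pencil

variable {d ℓ : ℕ} {hd : 1 ≤ d + 1} {hL : Odd (ℓ + 1) ∧ 1 < ℓ + 1} {b₀ b₁ : ℝ}
variable (i : KIdx d ℓ hd hL b₀ b₁) {N : ℕ} [NeZero N]
variable {ν : ℕ} {Nf : Fin ν → ℕ} [∀ j, NeZero (Nf j)]

/-- ★★★ **THE END OF PRINT's CHAIN WITH THE LAST INVERSE's N06 INPUT IN THEOREM 3.11's CURRENCY.**  n10-w2 g2's G-station (`B13OpsYPencilGreen` §3 ∕ §4) at the
record's letter algebra `𝔸 = M_N(ℂ)` (`N ≥ 1`, L²-operator norm, matrix-unit coordinates, `cb = cl = 1` by `B13MatrixUnitBasisNumerals`), for ANY letters `parS parB Gp`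
along pv27's pencil `U = e^{iηA′}U₀`: DISPLAYED are the R-station's output `hR` (the pencil letters of `R(U)` on the site sector — hence the G′ and X⁻¹ junctions), the
local part's pencil letters `hLoc` (`Δ(U) + Q*aQ(U)` on the bond sector — the lane's), NODE 00's numerals (`K₀`, the `D ∕ D*` row∕column sums `CgR ∕ CdC` and reading
range `r′`, readings `ℓS ℓF`, a fibre bound `m_F` of `ℓF`), `0 < R`, `0 < ρ`, and — INSTEAD OF `IsUnit (Δ_a(U₀))` + the (3.108)-type kernel bound of `G(U₀)` — the ONE form
bound `hco : m·trIP w Ψ Ψ ≤ trIP w Ψ (Δ_a(U₀)Ψ)` (`m > 0`, `w > 0`, `Θ ≥ 0` its ratio numeral); a rate `0 ≤ κ ≤ ρ∕4` with `8(Θ B_Δ)κ(m_F c₀(1,ρ∕2)^ν) ≤ mρ` where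
`B_Δ = B_L + CgR·N²·(K_η²)·(CdC·N²·K_η²)·B_R·e^{2ρr′}` is §3's constant of `B13OpsYPencilGreen` (`K_η = K₀e^{|η|R}`), and a target `0 ≤ ρ′ < κ`.  Conclusion:
`RawEntryLetters (A′ ↦ toMatrix B′ B′ (G(e^{iηA′}U₀))) (ℓF ∘ fst) (R∕(4·B_Δ·Θ(4∕m)·(m_F c₀(1,(κ−ρ′)∕3)^ν)² + 1)) ρ′ (2Θ(4∕m))`.
[cite: Balaban1985BackgroundPropagators, (3.26)–(3.27) p.395, Thm 3.3 p.399, Thm 3.4 and (3.50) p.400, (3.84)–(3.86) p.407, Thm 3.10 (3.107)–(3.108) pp.415–416, Thm 3.11 p.416;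
Balaban1984PropagatorsII, (2.19) and p.226, Lemma 2.1 (2.61) p.234; Balaban1988RG2Cluster, (2.5)–(2.7) pp.12–13, p.15; AizenmanWarzel2015, §10.3] -/
theorem rawEntryLetters_toMatrix_GAY_prodCfg_of_pencil_of_coercive
    (parS : SiteParY (Matrix (Fin N) (Fin N) ℂ) i) (parB : BondParY (Matrix (Fin N) (Fin N) ℂ) i) (Gp : SiteOpY (Matrix (Fin N) (Fin N) ℂ) i)
    (U₀ : CfgY (Matrix (Fin N) (Fin N) ℂ) i) (η : ℝ) {Rd K₀ : ℝ}
    (hU : ∀ μ x, ‖(U₀ μ x : Matrix (Fin N) (Fin N) ℂ)‖ ≤ K₀)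
    (hUi : ∀ μ x, ‖(((U₀ μ x)⁻¹ : (Matrix (Fin N) (Fin N) ℂ)ˣ) : Matrix (Fin N) (Fin N) ℂ)‖ ≤ K₀) (hK1 : 1 ≤ K₀) (hRpos : 0 < Rd)
    {CgR CdC : ℝ} (hCgR0 : 0 ≤ CgR) (hCgR : ∀ bb, ∑ z, |gradK i bb z| ≤ CgR) (hCdC0 : 0 ≤ CdC) (hCdC : ∀ bb, ∑ z, |divK i z bb| ≤ CdC)
    (ℓS : SiteY i → UT Nf) (ℓF : FBondY i → UT Nf) {r' : ℝ}
    (hℓG : ∀ bb z, gradK i bb z ≠ 0 → tdist1 Nf (ℓF bb) (ℓS z) ≤ r') (hℓD : ∀ z bb, divK i z bb ≠ 0 → tdist1 Nf (ℓS z) (ℓF bb) ≤ r')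
    {mF : ℕ} (hfibF : ∀ y : UT Nf, (univ.filter fun p : FBondY i × (Fin N × Fin N) => ℓF p.1 = y).card ≤ mF)
    {ρ BR BL : ℝ} (hρ : 0 < ρ)
    (hR : RawEntryLetters (fun a : Fin (d + 1) → Site (PV d ℓ i.m i.K hd hL) 0 → Matrix (Fin N) (Fin N) ℂ =>
      LinearMap.toMatrix
        ((Pi.basis fun _ : SiteY i => Matrix.stdBasis ℂ (Fin N) (Fin N)).reindex (Equiv.sigmaEquivProd (SiteY i) (Fin N × Fin N)))
        ((Pi.basis fun _ : SiteY i => Matrix.stdBasis ℂ (Fin N) (Fin N)).reindex (Equiv.sigmaEquivProd (SiteY i) (Fin N × Fin N)))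
        (RY i parS Gp (prodCfg U₀ η a)))
      (fun q : SiteY i × (Fin N × Fin N) => ℓS q.1) Rd ρ BR)
    (hLoc : RawEntryLetters (fun a : Fin (d + 1) → Site (PV d ℓ i.m i.K hd hL) 0 → Matrix (Fin N) (Fin N) ℂ =>
      LinearMap.toMatrix
        ((Pi.basis fun _ : FBondY i => Matrix.stdBasis ℂ (Fin N) (Fin N)).reindex (Equiv.sigmaEquivProd (FBondY i) (Fin N × Fin N)))
        ((Pi.basis fun _ : FBondY i => Matrix.stdBasis ℂ (Fin N) (Fin N)).reindex (Equiv.sigmaEquivProd (FBondY i) (Fin N × Fin N)))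
        (hessY i (prodCfg U₀ η a) + QsY i parB (prodCfg U₀ η a) ∘ₗ aY i ∘ₗ QY i parB (prodCfg U₀ η a)))
      (fun p : FBondY i × (Fin N × Fin N) => ℓF p.1) Rd ρ BL)
    -- INSTEAD OF N06's `IsUnit (Δ_a(U₀))` + the (3.108)-type kernel bound of `G(U₀)`: ONE form bound (Theorem 3.11 ∕ [4] p.226 for `Δ_a(U₀)`, quantitatively)
    (w : FBondY i → ℝ) (hw : ∀ s, 0 < w s) {Θ : ℝ} (hΘ0 : 0 ≤ Θ) (hΘ : ∀ s t : FBondY i, Real.sqrt (w s) ≤ Θ * Real.sqrt (w t))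
    {m : ℝ} (hm : 0 < m)
    (hco : ∀ Ψ : FBondY i → Matrix (Fin N) (Fin N) ℂ, m * trIP w Ψ Ψ ≤ trIP w Ψ (deltaAY i parS parB Gp U₀ Ψ))
    {κ : ℝ} (hκ : 0 ≤ κ) (hκ4 : κ ≤ ρ / 4)
    (hκm : 8 * (Θ * (BL + CgR * (Fintype.card (Fin N × Fin N)) * (1 * (K₀ * Real.exp (|η| * Rd) * 1 * (K₀ * Real.exp (|η| * Rd)))) *
        (CdC * (Fintype.card (Fin N × Fin N)) * (1 * (K₀ * Real.exp (|η| * Rd) * 1 * (K₀ * Real.exp (|η| * Rd))))) * BR * Real.exp (2 * ρ * r'))) *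
        κ * (mF * B6.c0 1 (ρ / 2) ^ ν) ≤ m * ρ)
    {ρ' : ℝ} (hρ'0 : 0 ≤ ρ') (hρ' : ρ' < κ) :
    RawEntryLetters (fun a : Fin (d + 1) → Site (PV d ℓ i.m i.K hd hL) 0 → Matrix (Fin N) (Fin N) ℂ =>
        LinearMap.toMatrix
          ((Pi.basis fun _ : FBondY i => Matrix.stdBasis ℂ (Fin N) (Fin N)).reindex (Equiv.sigmaEquivProd (FBondY i) (Fin N × Fin N)))
          ((Pi.basis fun _ : FBondY i => Matrix.stdBasis ℂ (Fin N) (Fin N)).reindex (Equiv.sigmaEquivProd (FBondY i) (Fin N × Fin N)))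
          (GAY i parS parB Gp (prodCfg U₀ η a)))
      (fun p : FBondY i × (Fin N × Fin N) => ℓF p.1)
      (Rd / (4 * ((BL + CgR * (Fintype.card (Fin N × Fin N)) * (1 * (K₀ * Real.exp (|η| * Rd) * 1 * (K₀ * Real.exp (|η| * Rd)))) *
          (CdC * (Fintype.card (Fin N × Fin N)) * (1 * (K₀ * Real.exp (|η| * Rd) * 1 * (K₀ * Real.exp (|η| * Rd))))) * BR * Real.exp (2 * ρ * r')) *
          (Θ * (4 / m)) * (mF * B6.c0 1 ((κ - ρ') / 3) ^ ν) * (mF * B6.c0 1 ((κ - ρ') / 3) ^ ν)) + 1))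
      ρ' (2 * (Θ * (4 / m))) := by
  -- Δ_a along the pencil at the record's algebra: the G-station's §3 with `cb = cl = 1`
  have hA := rawEntryLetters_toMatrix_deltaAY_prodCfg i (Matrix.stdBasis ℂ (Fin N) (Fin N)) U₀ η parS parB Gp hU hUi hK1 hRpos.le hCgR0 hCgR
    hCdC0 hCdC (norm_stdBasis_repr_le) zero_le_one (norm_stdBasis_le_one) zero_le_one ℓS ℓF hℓG hℓD hρ.le hR hLoc
  exact rawEntryLetters_toMatrix_GAY_prodCfg_located_of_coercive i parS parB Gp U₀ η hA hRpos hρ w hw hΘ0 hΘ hm hco hfibF hκ hκ4 hκm hρ'0 hρ'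

end Pencil

/-! ## §5. ★★★ At the record with the local part's letters BY NAME (the lane's module 76 §4): displayed `hR`, NODE 00's numerals, `hco` -/

section Record

variable {d ℓ : ℕ} {hd : 1 ≤ d + 1} {hL : Odd (ℓ + 1) ∧ 1 < ℓ + 1} {b₀ b₁ : ℝ}
variable (i : KIdx d ℓ hd hL b₀ b₁) {N : ℕ} [NeZero N]
variable {ν : ℕ} {Nf : Fin ν → ℕ} [∀ j, NeZero (Nf j)]

/-- ★★★ **`G(e^{iηA′}U₀)` IN N10 COORDINATES AT THE RECORD — THE LOCAL PART SUPPLIED BY NAME, THE LAST INVERSE's N06 INPUT = ONE FORM BOUND.**  §4 at NODE 00's bond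
averaging letter `parB := parBY i` (any `parS`, `Gp`) with its `hLoc` DISCHARGED by the lane's `B13OpsYPencilDeltaALetters.rawEntryLetters_toMatrix_localDeltaA_prodCfg`
(module 76 §4: `Δ(U) + Q*aQ(U)` along the pencil; its numerals — curl ∕ co-curl row sums `c₁ c₂`, contour incidence `N_b`, averaging support `D` and row sums `c_Q c_{Q*} c_a`,
the bond reading's numeral `s` — are displayed here in its own binders, `cb = cl = 1` at the matrix units).  What stays DISPLAYED: the R-station's output `hR` (hence
the G′ ∕ X⁻¹ junctions — Thms 3.1 ∕ 3.2 at `U₀`), NODE 00's numerals, a fibre bound `m_F` of `ℓF`, `0 < R`, `0 < ρ`, the ONE form bound `hco` for `Δ_a(U₀)` (Theorem 3.11 ∕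
[4] p.226, quantitatively — N06's), any `B′ ≥ B_Δ` dominating the assembled Δ_a constant (stated ONCE, in `hBΔ`), a rate `0 ≤ κ ≤ ρ∕4` with `8(ΘB′)κ(m_F c₀(1,ρ∕2)^ν) ≤ mρ`
and a target `0 ≤ ρ′ < κ`.  Conclusion: `RawEntryLetters (A′ ↦ toMatrix B′ B′ (G(e^{iηA′}U₀))) (ℓF ∘ fst) (R∕(4·B′·Θ(4∕m)·(m_F c₀(1,(κ−ρ′)∕3)^ν)² + 1)) ρ′ (2Θ(4∕m))`.
[cite: Balaban1985BackgroundPropagators, (3.10) p.392, (3.26)–(3.27) p.395, Thm 3.3 p.399, Thm 3.4 and (3.50) p.400, (3.84)–(3.86) p.407, Thm 3.10 (3.107)–(3.108) pp.415–416,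
Thm 3.11 p.416; Balaban1984PropagatorsII, (2.19) and p.226, Lemma 2.1 (2.61) p.234; Balaban1988RG2Cluster, (2.5)–(2.7) pp.12–13, p.15; AizenmanWarzel2015, §10.3] -/
theorem rawEntryLetters_toMatrix_GAY_parBY_prodCfg_of_pencil_of_coercive
    (parS : SiteParY (Matrix (Fin N) (Fin N) ℂ) i) (Gp : SiteOpY (Matrix (Fin N) (Fin N) ℂ) i)
    (U₀ : CfgY (Matrix (Fin N) (Fin N) ℂ) i) (η : ℝ) {Rd K₀ : ℝ} {D : ℕ}
    (hU : ∀ μ x, ‖(U₀ μ x : Matrix (Fin N) (Fin N) ℂ)‖ ≤ K₀)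
    (hUi : ∀ μ x, ‖(((U₀ μ x)⁻¹ : (Matrix (Fin N) (Fin N) ℂ)ˣ) : Matrix (Fin N) (Fin N) ℂ)‖ ≤ K₀) (hK1 : 1 ≤ K₀) (hRpos : 0 < Rd)
    -- 76 §4's numerals of the local part `Δ(U) + Q*aQ(U)`
    {c₁ c₂ : ℝ} (hc₀ : 0 ≤ c₁) (hc₂0 : 0 ≤ c₂) (hc₁ : ∀ p, ∑ b, |curlK i p b| ≤ c₁) (hc₂ : ∀ b, ∑ p, |cocurlK i b p| ≤ c₂)
    {Nb : ℝ} (hNb0 : 0 ≤ Nb)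
    (hNb : ∀ b : FBondY i,
      ((((Finset.univ : Finset (PlaqY i)) ×ˢ (Finset.univ : Finset (Fin 4))).filter fun pm => edgeY i pm.1 pm.2 = b).card : ℝ) ≤ Nb)
    (hD : ∀ ι b, qK i ι b ≠ 0 → Site.tdist (embIter (ι.1.1 : ℕ) ι.1.2.src) b.src ≤ D)
    (hD' : ∀ b ι, qsK i b ι ≠ 0 → Site.tdist (embIter (ι.1.1 : ℕ) ι.1.2.src) b.src ≤ D)
    {cQ cQs ca : ℝ} (hcQ0 : 0 ≤ cQ) (hcQs0 : 0 ≤ cQs) (hca0 : 0 ≤ ca) (hcQ : ∀ ι, ∑ b, |qK i ι b| ≤ cQ) (hcQs : ∀ b, ∑ ι, |qsK i b ι| ≤ cQs)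
    (hca : ∀ ι, ∑ ι', |aK i ι ι'| ≤ ca)
    (ℓF : FBondY i → UT Nf) {s : ℝ}
    (hℓp : ∀ p m l, tdist1 Nf (ℓF (edgeY i p m)) (ℓF (edgeY i p l)) ≤ s)
    (hℓq : ∀ b ι ι' b', qsK i b ι ≠ 0 → aK i ι ι' ≠ 0 → qK i ι' b' ≠ 0 → tdist1 Nf (ℓF b) (ℓF b') ≤ s)
    -- the G-station's `D ∕ D*` numerals and readings
    {CgR CdC : ℝ} (hCgR0 : 0 ≤ CgR) (hCgR : ∀ bb, ∑ z, |gradK i bb z| ≤ CgR) (hCdC0 : 0 ≤ CdC) (hCdC : ∀ bb, ∑ z, |divK i z bb| ≤ CdC)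
    (ℓS : SiteY i → UT Nf) {r' : ℝ}
    (hℓG : ∀ bb z, gradK i bb z ≠ 0 → tdist1 Nf (ℓF bb) (ℓS z) ≤ r') (hℓD : ∀ z bb, divK i z bb ≠ 0 → tdist1 Nf (ℓS z) (ℓF bb) ≤ r')
    {mF : ℕ} (hfibF : ∀ y : UT Nf, (univ.filter fun p : FBondY i × (Fin N × Fin N) => ℓF p.1 = y).card ≤ mF)
    -- the R-station's output (G′ and X⁻¹ inside)
    {ρ BR : ℝ} (hρ : 0 < ρ)
    (hR : RawEntryLetters (fun a : Fin (d + 1) → Site (PV d ℓ i.m i.K hd hL) 0 → Matrix (Fin N) (Fin N) ℂ =>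
      LinearMap.toMatrix
        ((Pi.basis fun _ : SiteY i => Matrix.stdBasis ℂ (Fin N) (Fin N)).reindex (Equiv.sigmaEquivProd (SiteY i) (Fin N × Fin N)))
        ((Pi.basis fun _ : SiteY i => Matrix.stdBasis ℂ (Fin N) (Fin N)).reindex (Equiv.sigmaEquivProd (SiteY i) (Fin N × Fin N)))
        (RY i parS Gp (prodCfg U₀ η a)))
      (fun q : SiteY i × (Fin N × Fin N) => ℓS q.1) Rd ρ BR)
    -- ONE dominating constant for the assembled Δ_a letters (76 §4's local constant at `cb = cl = 1` + the `D R D*` term), stated once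
    {B' : ℝ}
    (hBΔ : 1 * ((c₂ * ((K₀ * Real.exp (|η| * Rd)) * ((K₀ * Real.exp (|η| * Rd)) ^ 4 * (c₁ * ((K₀ * Real.exp (|η| * Rd)) * 1 * (K₀ * Real.exp (|η| * Rd))))) * (K₀ * Real.exp (|η| * Rd))) + 1 / 2 * (Nb * ((K₀ * Real.exp (|η| * Rd)) * (2 * (i.cf ^ 2 * (K₀ * Real.exp (|η| * Rd)) ^ 4) * (8 * ((K₀ * Real.exp (|η| * Rd)) * 1 * (K₀ * Real.exp (|η| * Rd))))) * (K₀ * Real.exp (|η| * Rd))))) + cQs * ((K₀ * Real.exp (|η| * Rd)) ^ D * (ca * (cQ * ((K₀ * Real.exp (|η| * Rd)) ^ D * 1 * (K₀ * Real.exp (|η| * Rd)) ^ D))) * (K₀ * Real.exp (|η| * Rd)) ^ D)) * Real.exp (ρ * s) +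
          CgR * (Fintype.card (Fin N × Fin N) : ℝ) * (1 * ((K₀ * Real.exp (|η| * Rd)) * 1 * (K₀ * Real.exp (|η| * Rd)))) * (CdC * (Fintype.card (Fin N × Fin N) : ℝ) * (1 * ((K₀ * Real.exp (|η| * Rd)) * 1 * (K₀ * Real.exp (|η| * Rd))))) * BR * Real.exp (2 * ρ * r') ≤ B')
    -- INSTEAD OF N06's `IsUnit (Δ_a(U₀))` + the (3.108)-type kernel bound of `G(U₀)`: ONE form bound (Theorem 3.11 ∕ [4] p.226 for `Δ_a(U₀)`, quantitatively)
    (w : FBondY i → ℝ) (hw : ∀ s, 0 < w s) {Θ : ℝ} (hΘ0 : 0 ≤ Θ) (hΘ : ∀ s t : FBondY i, Real.sqrt (w s) ≤ Θ * Real.sqrt (w t))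
    {m : ℝ} (hm : 0 < m)
    (hco : ∀ Ψ : FBondY i → Matrix (Fin N) (Fin N) ℂ, m * trIP w Ψ Ψ ≤ trIP w Ψ (deltaAY i parS (parBY i) Gp U₀ Ψ))
    {κ : ℝ} (hκ : 0 ≤ κ) (hκ4 : κ ≤ ρ / 4) (hκm : 8 * (Θ * B') * κ * (mF * B6.c0 1 (ρ / 2) ^ ν) ≤ m * ρ)
    {ρ' : ℝ} (hρ'0 : 0 ≤ ρ') (hρ' : ρ' < κ) :
    RawEntryLetters (fun a : Fin (d + 1) → Site (PV d ℓ i.m i.K hd hL) 0 → Matrix (Fin N) (Fin N) ℂ =>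
        LinearMap.toMatrix
          ((Pi.basis fun _ : FBondY i => Matrix.stdBasis ℂ (Fin N) (Fin N)).reindex (Equiv.sigmaEquivProd (FBondY i) (Fin N × Fin N)))
          ((Pi.basis fun _ : FBondY i => Matrix.stdBasis ℂ (Fin N) (Fin N)).reindex (Equiv.sigmaEquivProd (FBondY i) (Fin N × Fin N)))
          (GAY i parS (parBY i) Gp (prodCfg U₀ η a)))
      (fun p : FBondY i × (Fin N × Fin N) => ℓF p.1)
      (Rd / (4 * (B' * (Θ * (4 / m)) * (mF * B6.c0 1 ((κ - ρ') / 3) ^ ν) * (mF * B6.c0 1 ((κ - ρ') / 3) ^ ν)) + 1)) ρ' (2 * (Θ * (4 / m))) := by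
  -- the local part along the pencil at the record: the lane's 76 §4 with `cb = cl = 1`
  have hLoc := rawEntryLetters_toMatrix_localDeltaA_prodCfg i (Matrix.stdBasis ℂ (Fin N) (Fin N)) U₀ η hU hUi hK1 hRpos.le hc₀ hc₂0 hc₁ hc₂ hNb0 hNb
    hD hD' hcQ0 hcQs0 hca0 hcQ hcQs hca (norm_stdBasis_repr_le) zero_le_one (norm_stdBasis_le_one) zero_le_one ℓF hℓp hℓq hρ.le
  -- Δ_a along the pencil (the G-station's §3), then dominate its constant by `B'`
  have hA := rawEntryLetters_toMatrix_deltaAY_prodCfg i (Matrix.stdBasis ℂ (Fin N) (Fin N)) U₀ η parS (parBY i) Gp hU hUi hK1 hRpos.le hCgR0 hCgR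
    hCdC0 hCdC (norm_stdBasis_repr_le) zero_le_one (norm_stdBasis_le_one) zero_le_one ℓS ℓF hℓG hℓD hρ.le hR hLoc
  have hA' := rawEntryLetters_mono hA le_rfl le_rfl hBΔ
  exact rawEntryLetters_toMatrix_GAY_prodCfg_located_of_coercive i parS (parBY i) Gp U₀ η hA' hRpos hρ w hw hΘ0 hΘ hm hco hfibF hκ hκ4 hκm hρ'0 hρ'

end Record

/-! ## §6. ★★★ The qualitative knit to row 17's ONE clause: `PosDefTr w (Δ_a(U₀))` ⟹ `∃ m > 0, hco` (n06's `exists_pos_coer_of_posDefTr`) ⟹ G's letters at SOME rate -/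

section RowSeventeen

variable {d ℓ : ℕ} {hd : 1 ≤ d + 1} {hL : Odd (ℓ + 1) ∧ 1 < ℓ + 1} {b₀ b₁ : ℝ}
variable (i : KIdx d ℓ hd hL b₀ b₁) {N : ℕ}
variable {ν : ℕ} {Nf : Fin ν → ℕ} [∀ j, NeZero (Nf j)]

/-- ★ **A6 — THE DISPLAYED FORM BOUND IS INHABITED AT THE RECORD's LETTERS** (unit background): at `U₀ = 1` def-Y's v4 `Δ_a(1) = deltaAY i (parSymY i) (parBY i)
(GpY i (parSymY i)) 1` is coercive in the flat trace pairing for SOME `m > 0` — dag-n06-j's `posDefTr_deltaAY_parSymY_one` (row 17's one clause HOLDS at `U = 1`) read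
quantitatively by n06's `B9Thm311CoercivePureGaugeAtLettersY.exists_pos_coer_of_posDefTr` (BY NAME); [4]'s flat case qualitatively.  So the binder class `(w := 1, m, hco)` of §3–§5 is jointly satisfiable with NODE 00's
genuine operator. [cite: Balaban1984PropagatorsII, (2.19) and p.226; Balaban1985BackgroundPropagators, Thm 3.11 p.416] -/
theorem exists_coercive_deltaAY_parSymY_one :
    ∃ m : ℝ, 0 < m ∧ ∀ Ψ : FBondY i → Matrix (Fin N) (Fin N) ℂ,
      m * trIP (fun _ => (1 : ℝ)) Ψ Ψ ≤
        trIP (fun _ => (1 : ℝ)) Ψ (deltaAY i (parSymY i) (parBY i) (GpY i (parSymY i)) (fun _ _ => 1 : CfgY (Matrix (Fin N) (Fin N) ℂ) i) Ψ) :=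
  exists_pos_coer_of_posDefTr (fun _ => one_pos) (posDefTr_deltaAY_parSymY_one i)

/-- ★★★ **THE G-JUNCTION FROM ROW 17's ONE CLAUSE.**  If N06's located residual `PosDefTr w (Δ_a(U₀))` (`B9Thm311PosAtRecordV4` §5 — Theorem 3.11's printed conclusion
for `Δ_a`, equivalently the input from which row 17 follows at the record) holds at the one real background `U₀`, then from Δ_a's pencil letters `hA` (the junction's own
datum, `0 < R`, `0 < ρ`), the weight's ratio numeral `Θ` and a fibre bound of `loc`, NODE 00's propagator has N10 letters along the pencil AT SOME POSITIVE RATE: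
`∃ κ > 0, ∃ B_G ≥ 0, ∀ 0 ≤ ρ′ < κ, ∃ R₁ > 0, RawEntryLetters (A′ ↦ toMatrix B′ B′ (G(e^{iηA′}U₀))) loc R₁ ρ′ B_G` — `m` from n06's `exists_pos_coer_of_posDefTr`, `κ` from
`NodeOLettersSqrtExpDecay.exists_uniform_rate`, then §3.  QUALITATIVE on purpose: the rate and radius depend on the unlocated `m` (a finite-lattice number); the
quantitative road is §3–§5 with a located `m`.  N06 content = row 17's one clause at `U₀`, nothing else.
[cite: Balaban1985BackgroundPropagators, (3.26)–(3.27) p.395, Thm 3.3 p.399, Thm 3.4 p.400, (3.84)–(3.86) p.407, Thm 3.10 (3.108) p.416, Thm 3.11 p.416;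
Balaban1984PropagatorsII, p.226; Balaban1988RG2Cluster, (2.5)–(2.7) pp.12–13; AizenmanWarzel2015, §10.3] -/
theorem exists_rawEntryLetters_toMatrix_GAY_prodCfg_of_posDefTr (parS : SiteParY (Matrix (Fin N) (Fin N) ℂ) i)
    (parB : BondParY (Matrix (Fin N) (Fin N) ℂ) i) (Gp : SiteOpY (Matrix (Fin N) (Fin N) ℂ) i) (U₀ : CfgY (Matrix (Fin N) (Fin N) ℂ) i) (η : ℝ)
    {loc : FBondY i × (Fin N × Fin N) → UT Nf} {R ρ B : ℝ}
    (hA : RawEntryLetters (fun a : Fin (d + 1) → Site (PV d ℓ i.m i.K hd hL) 0 → Matrix (Fin N) (Fin N) ℂ =>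
      LinearMap.toMatrix
        ((Pi.basis fun _ : FBondY i => Matrix.stdBasis ℂ (Fin N) (Fin N)).reindex (Equiv.sigmaEquivProd (FBondY i) (Fin N × Fin N)))
        ((Pi.basis fun _ : FBondY i => Matrix.stdBasis ℂ (Fin N) (Fin N)).reindex (Equiv.sigmaEquivProd (FBondY i) (Fin N × Fin N)))
        (deltaAY i parS parB Gp (prodCfg U₀ η a))) loc R ρ B)
    (hR : 0 < R) (hρ : 0 < ρ)
    (w : FBondY i → ℝ) (hw : ∀ s, 0 < w s) {Θ : ℝ} (hΘ0 : 0 ≤ Θ) (hΘ : ∀ s t : FBondY i, Real.sqrt (w s) ≤ Θ * Real.sqrt (w t))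
    -- N06's located residual at the one real background: row 17's ONE clause
    (hpd : PosDefTr w (deltaAY i parS parB Gp U₀))
    {mF : ℕ} (hfib : ∀ y : UT Nf, (univ.filter fun k => loc k = y).card ≤ mF) :
    ∃ κ : ℝ, 0 < κ ∧ ∃ BG : ℝ, 0 ≤ BG ∧ ∀ ρ' : ℝ, 0 ≤ ρ' → ρ' < κ → ∃ R₁ : ℝ, 0 < R₁ ∧
      RawEntryLetters (fun a : Fin (d + 1) → Site (PV d ℓ i.m i.K hd hL) 0 → Matrix (Fin N) (Fin N) ℂ =>
          LinearMap.toMatrix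
            ((Pi.basis fun _ : FBondY i => Matrix.stdBasis ℂ (Fin N) (Fin N)).reindex (Equiv.sigmaEquivProd (FBondY i) (Fin N × Fin N)))
            ((Pi.basis fun _ : FBondY i => Matrix.stdBasis ℂ (Fin N) (Fin N)).reindex (Equiv.sigmaEquivProd (FBondY i) (Fin N × Fin N)))
            (GAY i parS parB Gp (prodCfg U₀ η a))) loc R₁ ρ' BG := by
  -- the clause is coercivity with SOME `m > 0`
  obtain ⟨m, hm, hco⟩ := exists_pos_coer_of_posDefTr hw hpd
  -- a rate `κ` with `κ ≤ ρ∕4` and the Combes–Thomas smallness for the letters `(m; ΘB, ρ, c_V)`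
  have hV0 : 0 ≤ (mF : ℝ) * B6.c0 1 (ρ / 2) ^ ν := mul_nonneg (Nat.cast_nonneg _) (pow_nonneg (c0_nonneg _ _) _)
  obtain ⟨κ, hκ0, hκ4, hκm⟩ := exists_uniform_rate (m := m) (a := Θ * B) (κ₀ := ρ) (cV := (mF : ℝ) * B6.c0 1 (ρ / 2) ^ ν) hm hρ
    (mul_nonneg hΘ0 hA.B_nonneg) hV0
  refine ⟨κ, hκ0, 2 * (Θ * (4 / m)), by positivity, fun ρ' hρ'0 hρ' => ?_⟩
  refine ⟨R / (4 * (B * (Θ * (4 / m)) * (mF * B6.c0 1 ((κ - ρ') / 3) ^ ν) * (mF * B6.c0 1 ((κ - ρ') / 3) ^ ν)) + 1), ?_,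
    rawEntryLetters_toMatrix_GAY_prodCfg_located_of_coercive i parS parB Gp U₀ η hA hR hρ w hw hΘ0 hΘ hm hco hfib hκ0.le hκ4 hκm hρ'0 hρ'⟩
  have hW0 : 0 ≤ (mF : ℝ) * B6.c0 1 ((κ - ρ') / 3) ^ ν := mul_nonneg (Nat.cast_nonneg _) (pow_nonneg (c0_nonneg _ _) _)
  exact thinRadius_pos hR (mul_nonneg (mul_nonneg (mul_nonneg hA.B_nonneg (by positivity)) hW0) hW0)

/-- ★★★ **… AND AT THE RECORD WITH THE LOCAL PART BY NAME** (§5's binder set with `(m, hco, κ, ρ′)` replaced by row 17's ONE clause `hpd : PosDefTr w (Δ_a(U₀))`):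
`∃ κ > 0, ∃ B_G ≥ 0, ∀ 0 ≤ ρ′ < κ, ∃ R₁ > 0, RawEntryLetters (A′ ↦ toMatrix B′ B′ (G(e^{iηA′}U₀))) (ℓF ∘ fst) R₁ ρ′ B_G` at `parB := parBY i` — displayed: the R-station's
output `hR`, NODE 00's numerals, ONE dominating constant `B′ ≥ B_Δ`, and the clause.  [cite: Balaban1985BackgroundPropagators, (3.26)–(3.27) p.395, Thm 3.3 p.399,
Thm 3.4 p.400, (3.84)–(3.86) p.407, Thm 3.10 (3.108) p.416, Thm 3.11 p.416; Balaban1984PropagatorsII, p.226; Balaban1988RG2Cluster, (2.5)–(2.7) pp.12–13] -/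
theorem exists_rawEntryLetters_toMatrix_GAY_parBY_prodCfg_of_pencil_of_posDefTr [NeZero N]
    (parS : SiteParY (Matrix (Fin N) (Fin N) ℂ) i) (Gp : SiteOpY (Matrix (Fin N) (Fin N) ℂ) i)
    (U₀ : CfgY (Matrix (Fin N) (Fin N) ℂ) i) (η : ℝ) {Rd K₀ : ℝ} {D : ℕ}
    (hU : ∀ μ x, ‖(U₀ μ x : Matrix (Fin N) (Fin N) ℂ)‖ ≤ K₀)
    (hUi : ∀ μ x, ‖(((U₀ μ x)⁻¹ : (Matrix (Fin N) (Fin N) ℂ)ˣ) : Matrix (Fin N) (Fin N) ℂ)‖ ≤ K₀) (hK1 : 1 ≤ K₀) (hRpos : 0 < Rd)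
    {c₁ c₂ : ℝ} (hc₀ : 0 ≤ c₁) (hc₂0 : 0 ≤ c₂) (hc₁ : ∀ p, ∑ b, |curlK i p b| ≤ c₁) (hc₂ : ∀ b, ∑ p, |cocurlK i b p| ≤ c₂)
    {Nb : ℝ} (hNb0 : 0 ≤ Nb)
    (hNb : ∀ b : FBondY i,
      ((((Finset.univ : Finset (PlaqY i)) ×ˢ (Finset.univ : Finset (Fin 4))).filter fun pm => edgeY i pm.1 pm.2 = b).card : ℝ) ≤ Nb)
    (hD : ∀ ι b, qK i ι b ≠ 0 → Site.tdist (embIter (ι.1.1 : ℕ) ι.1.2.src) b.src ≤ D)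
    (hD' : ∀ b ι, qsK i b ι ≠ 0 → Site.tdist (embIter (ι.1.1 : ℕ) ι.1.2.src) b.src ≤ D)
    {cQ cQs ca : ℝ} (hcQ0 : 0 ≤ cQ) (hcQs0 : 0 ≤ cQs) (hca0 : 0 ≤ ca) (hcQ : ∀ ι, ∑ b, |qK i ι b| ≤ cQ) (hcQs : ∀ b, ∑ ι, |qsK i b ι| ≤ cQs)
    (hca : ∀ ι, ∑ ι', |aK i ι ι'| ≤ ca)
    (ℓF : FBondY i → UT Nf) {s : ℝ}
    (hℓp : ∀ p m l, tdist1 Nf (ℓF (edgeY i p m)) (ℓF (edgeY i p l)) ≤ s)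
    (hℓq : ∀ b ι ι' b', qsK i b ι ≠ 0 → aK i ι ι' ≠ 0 → qK i ι' b' ≠ 0 → tdist1 Nf (ℓF b) (ℓF b') ≤ s)
    {CgR CdC : ℝ} (hCgR0 : 0 ≤ CgR) (hCgR : ∀ bb, ∑ z, |gradK i bb z| ≤ CgR) (hCdC0 : 0 ≤ CdC) (hCdC : ∀ bb, ∑ z, |divK i z bb| ≤ CdC)
    (ℓS : SiteY i → UT Nf) {r' : ℝ}
    (hℓG : ∀ bb z, gradK i bb z ≠ 0 → tdist1 Nf (ℓF bb) (ℓS z) ≤ r') (hℓD : ∀ z bb, divK i z bb ≠ 0 → tdist1 Nf (ℓS z) (ℓF bb) ≤ r')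
    {mF : ℕ} (hfibF : ∀ y : UT Nf, (univ.filter fun p : FBondY i × (Fin N × Fin N) => ℓF p.1 = y).card ≤ mF)
    {ρ BR : ℝ} (hρ : 0 < ρ)
    (hR : RawEntryLetters (fun a : Fin (d + 1) → Site (PV d ℓ i.m i.K hd hL) 0 → Matrix (Fin N) (Fin N) ℂ =>
      LinearMap.toMatrix
        ((Pi.basis fun _ : SiteY i => Matrix.stdBasis ℂ (Fin N) (Fin N)).reindex (Equiv.sigmaEquivProd (SiteY i) (Fin N × Fin N)))
        ((Pi.basis fun _ : SiteY i => Matrix.stdBasis ℂ (Fin N) (Fin N)).reindex (Equiv.sigmaEquivProd (SiteY i) (Fin N × Fin N)))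
        (RY i parS Gp (prodCfg U₀ η a)))
      (fun q : SiteY i × (Fin N × Fin N) => ℓS q.1) Rd ρ BR)
    {B' : ℝ}
    (hBΔ : 1 * ((c₂ * ((K₀ * Real.exp (|η| * Rd)) * ((K₀ * Real.exp (|η| * Rd)) ^ 4 * (c₁ * ((K₀ * Real.exp (|η| * Rd)) * 1 * (K₀ * Real.exp (|η| * Rd))))) * (K₀ * Real.exp (|η| * Rd))) + 1 / 2 * (Nb * ((K₀ * Real.exp (|η| * Rd)) * (2 * (i.cf ^ 2 * (K₀ * Real.exp (|η| * Rd)) ^ 4) * (8 * ((K₀ * Real.exp (|η| * Rd)) * 1 * (K₀ * Real.exp (|η| * Rd))))) * (K₀ * Real.exp (|η| * Rd))))) + cQs * ((K₀ * Real.exp (|η| * Rd)) ^ D * (ca * (cQ * ((K₀ * Real.exp (|η| * Rd)) ^ D * 1 * (K₀ * Real.exp (|η| * Rd)) ^ D))) * (K₀ * Real.exp (|η| * Rd)) ^ D)) * Real.exp (ρ * s) +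
          CgR * (Fintype.card (Fin N × Fin N) : ℝ) * (1 * ((K₀ * Real.exp (|η| * Rd)) * 1 * (K₀ * Real.exp (|η| * Rd)))) * (CdC * (Fintype.card (Fin N × Fin N) : ℝ) * (1 * ((K₀ * Real.exp (|η| * Rd)) * 1 * (K₀ * Real.exp (|η| * Rd))))) * BR * Real.exp (2 * ρ * r') ≤ B')
    (w : FBondY i → ℝ) (hw : ∀ s, 0 < w s) {Θ : ℝ} (hΘ0 : 0 ≤ Θ) (hΘ : ∀ s t : FBondY i, Real.sqrt (w s) ≤ Θ * Real.sqrt (w t))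
    -- row 17's ONE clause at the one real background
    (hpd : PosDefTr w (deltaAY i parS (parBY i) Gp U₀)) :
    ∃ κ : ℝ, 0 < κ ∧ ∃ BG : ℝ, 0 ≤ BG ∧ ∀ ρ' : ℝ, 0 ≤ ρ' → ρ' < κ → ∃ R₁ : ℝ, 0 < R₁ ∧
      RawEntryLetters (fun a : Fin (d + 1) → Site (PV d ℓ i.m i.K hd hL) 0 → Matrix (Fin N) (Fin N) ℂ =>
          LinearMap.toMatrix
            ((Pi.basis fun _ : FBondY i => Matrix.stdBasis ℂ (Fin N) (Fin N)).reindex (Equiv.sigmaEquivProd (FBondY i) (Fin N × Fin N)))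
            ((Pi.basis fun _ : FBondY i => Matrix.stdBasis ℂ (Fin N) (Fin N)).reindex (Equiv.sigmaEquivProd (FBondY i) (Fin N × Fin N)))
            (GAY i parS (parBY i) Gp (prodCfg U₀ η a))) (fun p : FBondY i × (Fin N × Fin N) => ℓF p.1) R₁ ρ' BG := by
  -- Δ_a along the pencil at the record (76 §4 ∘ the G-station's §3), dominated by `B'`
  have hLoc := rawEntryLetters_toMatrix_localDeltaA_prodCfg i (Matrix.stdBasis ℂ (Fin N) (Fin N)) U₀ η hU hUi hK1 hRpos.le hc₀ hc₂0 hc₁ hc₂ hNb0 hNb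
    hD hD' hcQ0 hcQs0 hca0 hcQ hcQs hca (norm_stdBasis_repr_le) zero_le_one (norm_stdBasis_le_one) zero_le_one ℓF hℓp hℓq hρ.le
  have hA := rawEntryLetters_toMatrix_deltaAY_prodCfg i (Matrix.stdBasis ℂ (Fin N) (Fin N)) U₀ η parS (parBY i) Gp hU hUi hK1 hRpos.le hCgR0 hCgR
    hCdC0 hCdC (norm_stdBasis_repr_le) zero_le_one (norm_stdBasis_le_one) zero_le_one ℓS ℓF hℓG hℓD hρ.le hR hLoc
  have hA' := rawEntryLetters_mono hA le_rfl le_rfl hBΔ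
  exact exists_rawEntryLetters_toMatrix_GAY_prodCfg_of_posDefTr i parS (parBY i) Gp U₀ η hA' hRpos hρ w hw hΘ0 hΘ hpd hfibF

end RowSeventeen

end Literature.MathematicalPhysics.QuantumFieldTheory.Balaban1983to89.B13GreenCentreDecayOfCoercive

end
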